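/-
HONEST FRAMING: certified error envelopes and provably optimal rounding/accumulation schemes for
low-precision formats under stated cost models; every table by two implementations; no hardware
or vendor claims.
-/
import Summits.Ventures.CertifiedArithmetic.LowPrec.OptDemotionTreeWitness

/-!
# The demotion law (Theorem T8), part 5: the LINE FAMILY of a summation tree

Towards OPTIMA.md §B T8(b)(iii) (Conjecture D: `D_t = Q_t` for every tree).  The upper bound
`D_t ≤ Q_t` is proved (parts 5a–5e) through a value-function invariant: if a subtree `t` of
nonnegative `F(q, emin)` data COMPUTES `v` with `σ = ufp(v) ≤ v = σ(1+x) < 2σ`, then its exact sum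
exceeds `v` by at most `σ·(α + λ x)` for some "line" `(α, λ)` of the finite family `goodLines u t`
defined here (`u = u_q`):
* the leaf has the single line `(0, 0)`;
* a node `a·b` (with `μ = M - 1`, `M` the tree polynomial) has the lines
  `F1(α,λ) = (α + u + u μ_b, λ)` for `(α,λ)` a line of `a` (a keeps the budget, b is absorbed into the
  half-ulp), `F2` symmetrically, `F3(α,λ) = (u + μ_a + u λ, α)` for `(α,λ)` a line of `b` PROVIDED its
  slope `α` is at most its intercept (a sits exactly at the power of two, b receives the excess), and
  `F4` symmetrically.
These four transforms are precisely the four options of opt's coupled recursion, so every line lies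
below `treeQf` (`line_le_treeQf`: `1 + ρ + α + λρ ≤ Q_t(ρ)` for all `ρ > 0`), every line has
`0 ≤ λ ≤ α ≤ μ_t` (`goodLines_bounds`), and the μ-line `(μ_t, 0)` of Theorem U is always present
(`mu_mem_goodLines`).  The analytic node step is `OptDemotionNodeI/III/IIIs.lean`, the induction and
the demotion step are `OptDemotionEveryTree.lean`.
-/

namespace Summit.Ventures.CertifiedArithmetic.LowPrec.Opt

open Literature.ComputerArithmetic.JeannerodRump2018
open Literature.ComputerArithmetic.JeannerodRump2018.SumTree

/-! ## The family of good lines -/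

/-- The finite family of (intercept, slope) pairs bounding the deficit of `t` one excess-unit at a
time; only lines with slope ≤ intercept are created by the transposing transforms `F3`, `F4`. -/
def goodLines (u : ℚ) : SumTree → List (ℚ × ℚ)
  | .leaf _ => [(0, 0)]
  | .node a b =>
      (goodLines u a).map (fun l => (l.1 + u + u * (treeM u b - 1), l.2)) ++
      (goodLines u b).map (fun l => (l.1 + u + u * (treeM u a - 1), l.2)) ++
      ((goodLines u b).filter (fun l => decide (l.1 ≤ u + (treeM u a - 1) + u * l.2))).map
        (fun l => (u + (treeM u a - 1) + u * l.2, l.1)) ++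
      ((goodLines u a).filter (fun l => decide (l.1 ≤ u + (treeM u b - 1) + u * l.2))).map
        (fun l => (u + (treeM u b - 1) + u * l.2, l.1))

/-- The leaf has the single line `(0,0)`. -/
@[simp] theorem goodLines_leaf (u x : ℚ) : goodLines u (.leaf x) = [(0, 0)] := rfl

/-- `F1`: a line of `a` shifted by `u·M_b` is a line of `a·b`. -/
theorem mem_goodLines_F1 {u : ℚ} {a b : SumTree} {α lam : ℚ} (h : (α, lam) ∈ goodLines u a) :
    (α + u + u * (treeM u b - 1), lam) ∈ goodLines u (.node a b) := by
  simp only [goodLines, List.mem_append, List.mem_map]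
  exact Or.inl (Or.inl (Or.inl ⟨(α, lam), h, rfl⟩))

/-- `F2`: a line of `b` shifted by `u·M_a` is a line of `a·b`. -/
theorem mem_goodLines_F2 {u : ℚ} {a b : SumTree} {α lam : ℚ} (h : (α, lam) ∈ goodLines u b) :
    (α + u + u * (treeM u a - 1), lam) ∈ goodLines u (.node a b) := by
  simp only [goodLines, List.mem_append, List.mem_map]
  exact Or.inl (Or.inl (Or.inr ⟨(α, lam), h, rfl⟩))

/-- `F3`: the transpose of a line of `b` (when its slope is at most its intercept). -/
theorem mem_goodLines_F3 {u : ℚ} {a b : SumTree} {α lam : ℚ} (h : (α, lam) ∈ goodLines u b)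
    (hg : α ≤ u + (treeM u a - 1) + u * lam) :
    (u + (treeM u a - 1) + u * lam, α) ∈ goodLines u (.node a b) := by
  simp only [goodLines, List.mem_append, List.mem_map, List.mem_filter, decide_eq_true_eq]
  exact Or.inl (Or.inr ⟨(α, lam), ⟨h, hg⟩, rfl⟩)

/-- `F4`: the transpose of a line of `a` (when its slope is at most its intercept). -/
theorem mem_goodLines_F4 {u : ℚ} {a b : SumTree} {α lam : ℚ} (h : (α, lam) ∈ goodLines u a)
    (hg : α ≤ u + (treeM u b - 1) + u * lam) :
    (u + (treeM u b - 1) + u * lam, α) ∈ goodLines u (.node a b) := by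
  simp only [goodLines, List.mem_append, List.mem_map, List.mem_filter, decide_eq_true_eq]
  exact Or.inr ⟨(α, lam), ⟨h, hg⟩, rfl⟩

/-- Case analysis on membership in the family of a node. -/
theorem mem_goodLines_node {u : ℚ} {a b : SumTree} {l : ℚ × ℚ} (h : l ∈ goodLines u (.node a b)) :
    (∃ m ∈ goodLines u a, l = (m.1 + u + u * (treeM u b - 1), m.2)) ∨
    (∃ m ∈ goodLines u b, l = (m.1 + u + u * (treeM u a - 1), m.2)) ∨
    (∃ m ∈ goodLines u b, m.1 ≤ u + (treeM u a - 1) + u * m.2 ∧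
        l = (u + (treeM u a - 1) + u * m.2, m.1)) ∨
    (∃ m ∈ goodLines u a, m.1 ≤ u + (treeM u b - 1) + u * m.2 ∧
        l = (u + (treeM u b - 1) + u * m.2, m.1)) := by
  simp only [goodLines, List.mem_append, List.mem_map, List.mem_filter, decide_eq_true_eq] at h
  rcases h with ((⟨m, hm, rfl⟩ | ⟨m, hm, rfl⟩) | ⟨m, ⟨hm, hg⟩, rfl⟩) | ⟨m, ⟨hm, hg⟩, rfl⟩
  · exact Or.inl ⟨m, hm, rfl⟩
  · exact Or.inr (Or.inl ⟨m, hm, rfl⟩)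
  · exact Or.inr (Or.inr (Or.inl ⟨m, hm, hg, rfl⟩))
  · exact Or.inr (Or.inr (Or.inr ⟨m, hm, hg, rfl⟩))

/-! ## Structural facts -/

/-- `M(a·b) - 1 ≥ (M_a - 1) + u·M_b` and symmetrically (for `0 ≤ u ≤ 1`). -/
theorem treeM_node_sub_one_ge {u : ℚ} (hu0 : 0 ≤ u) (hu1 : u ≤ 1) (a b : SumTree) :
    (treeM u a - 1) + u + u * (treeM u b - 1) ≤ treeM u (.node a b) - 1 ∧
    (treeM u b - 1) + u + u * (treeM u a - 1) ≤ treeM u (.node a b) - 1 := by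
  have ha := one_le_treeM hu0 a
  have hb := one_le_treeM hu0 b
  rw [treeM_node]
  constructor
  · have := add_mul_le_max_add_mul_min hu1 (treeM u a) (treeM u b)
    linarith
  · have := add_mul_le_max_add_mul_min hu1 (treeM u b) (treeM u a)
    rw [max_comm, min_comm] at this
    linarith

/-- Every good line satisfies `0 ≤ λ ≤ α ≤ M_t - 1` (for `0 ≤ u ≤ 1`). -/
theorem goodLines_bounds {u : ℚ} (hu0 : 0 ≤ u) (hu1 : u ≤ 1) :
    ∀ (t : SumTree) (l : ℚ × ℚ), l ∈ goodLines u t → 0 ≤ l.2 ∧ l.2 ≤ l.1 ∧ l.1 ≤ treeM u t - 1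
  | .leaf x, l, h => by
      simp only [goodLines_leaf, List.mem_singleton] at h
      subst h; simp
  | .node a b, l, h => by
      have hMa := one_le_treeM hu0 a
      have hMb := one_le_treeM hu0 b
      have hN := treeM_node_sub_one_ge hu0 hu1 a b
      rcases mem_goodLines_node h with ⟨m, hm, rfl⟩ | ⟨m, hm, rfl⟩ | ⟨m, hm, hg, rfl⟩ | ⟨m, hm, hg, rfl⟩
      · obtain ⟨h0, h1, h2⟩ := goodLines_bounds hu0 hu1 a m hm
        refine ⟨h0, ?_, ?_⟩
        · dsimp only; nlinarith [mul_nonneg hu0 (by linarith : (0:ℚ) ≤ treeM u b - 1)]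
        · dsimp only; linarith [hN.1]
      · obtain ⟨h0, h1, h2⟩ := goodLines_bounds hu0 hu1 b m hm
        refine ⟨h0, ?_, ?_⟩
        · dsimp only; nlinarith [mul_nonneg hu0 (by linarith : (0:ℚ) ≤ treeM u a - 1)]
        · dsimp only; linarith [hN.2]
      · obtain ⟨h0, h1, h2⟩ := goodLines_bounds hu0 hu1 b m hm
        refine ⟨by dsimp only; linarith, by dsimp only; exact hg, ?_⟩
        dsimp only
        have : u * m.2 ≤ u * (treeM u b - 1) := mul_le_mul_of_nonneg_left (by linarith) hu0
        linarith [hN.1]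
      · obtain ⟨h0, h1, h2⟩ := goodLines_bounds hu0 hu1 a m hm
        refine ⟨by dsimp only; linarith, by dsimp only; exact hg, ?_⟩
        dsimp only
        have : u * m.2 ≤ u * (treeM u a - 1) := mul_le_mul_of_nonneg_left (by linarith) hu0
        linarith [hN.2]

/-- THE μ-LINE: `(M_t - 1, 0)` is always a good line (Theorem U inside the family). -/
theorem mu_mem_goodLines {u : ℚ} (hu0 : 0 ≤ u) (hu1 : u ≤ 1) :
    ∀ t : SumTree, (treeM u t - 1, 0) ∈ goodLines u t
  | .leaf x => by simp
  | .node a b => by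
      have ha := mu_mem_goodLines hu0 hu1 a
      have hb := mu_mem_goodLines hu0 hu1 b
      have hMa := one_le_treeM hu0 a
      have hMb := one_le_treeM hu0 b
      rcases le_total (treeM u b) (treeM u a) with hle | hle
      · have key : treeM u (.node a b) - 1 = (treeM u a - 1) + u + u * (treeM u b - 1) := by
          rw [treeM_node, max_eq_left hle, min_eq_right hle]; ring
        rw [key]; exact mem_goodLines_F1 ha
      · have key : treeM u (.node a b) - 1 = (treeM u b - 1) + u + u * (treeM u a - 1) := by
          rw [treeM_node, max_eq_right hle, min_eq_left hle]; ring
        rw [key]; exact mem_goodLines_F2 hb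

/-! ## Every good line lies below opt's coupled polynomial `treeQf` -/

/-- EVERY GOOD LINE IS BELOW `Q_t`: `1 + ρ + α + λρ ≤ treeQf u t ρ` for every `ρ > 0` (`u > 0`) —
the four transforms are dominated by the four options of the recursion (for `F3`/`F4` the inner
value is read at the transposed ratio `u/ρ`). -/
theorem line_le_treeQf {u : ℚ} (hu : 0 < u) :
    ∀ (t : SumTree) (l : ℚ × ℚ), l ∈ goodLines u t → ∀ ρ : ℚ, 0 < ρ →
      1 + ρ + l.1 + l.2 * ρ ≤ treeQf u t ρ
  | .leaf x, l, h, ρ, _ => by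
      simp only [goodLines_leaf, List.mem_singleton] at h
      subst h; simp
  | .node a b, l, h, ρ, hρ => by
      rw [treeQf_node]
      rcases mem_goodLines_node h with ⟨m, hm, rfl⟩ | ⟨m, hm, rfl⟩ | ⟨m, hm, -, rfl⟩ | ⟨m, hm, -, rfl⟩
      · have ih := line_le_treeQf hu a m hm ρ hρ
        have : 1 + ρ + (m.1 + u + u * (treeM u b - 1)) + m.2 * ρ ≤ treeQf u a ρ + u * treeM u b := by
          linarith
        exact this.trans ((le_max_left _ _).trans (le_max_left _ _))
      · have ih := line_le_treeQf hu b m hm ρ hρ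
        have : 1 + ρ + (m.1 + u + u * (treeM u a - 1)) + m.2 * ρ ≤ treeQf u b ρ + u * treeM u a := by
          linarith
        exact this.trans ((le_max_right _ _).trans (le_max_left _ _))
      · have ih := line_le_treeQf hu b m hm (u / ρ) (div_pos hu hρ)
        have h2 := mul_le_mul_of_nonneg_left ih hρ.le
        have e : ρ * (1 + u / ρ + m.1 + m.2 * (u / ρ)) = ρ + u + m.1 * ρ + u * m.2 := by
          field_simp
        have key : 1 + ρ + (u + (treeM u a - 1) + u * m.2) + m.1 * ρ
            ≤ treeM u a + ρ * treeQf u b (u / ρ) := by linarith [e ▸ h2]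
        exact key.trans ((le_max_left _ _).trans (le_max_right _ _))
      · have ih := line_le_treeQf hu a m hm (u / ρ) (div_pos hu hρ)
        have h2 := mul_le_mul_of_nonneg_left ih hρ.le
        have e : ρ * (1 + u / ρ + m.1 + m.2 * (u / ρ)) = ρ + u + m.1 * ρ + u * m.2 := by
          field_simp
        have key : 1 + ρ + (u + (treeM u b - 1) + u * m.2) + m.1 * ρ
            ≤ treeM u b + ρ * treeQf u a (u / ρ) := by linarith [e ▸ h2]
        exact key.trans ((le_max_right _ _).trans (le_max_right _ _))

end Summit.Ventures.CertifiedArithmetic.LowPrec.Opt
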